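import Literature.NumberTheory.LFunctions.ZetaLowHeightZeros
import HarnessLib

/-!
# Kernel-checked certificate: `ζ' ≠ 0` on `(0, ½) × (8, 21/2]`

Trunk T-ANT (NumberTheory/LFunctions). One of the seven certificate files of the certified
low-height computation behind `Literature.NumberTheory.LFunctions.speiser_iff` (Levinson–Montgomery's Theorem 1 (1.2) needs
`ζ ≠ 0` on `(0,½) × (0, 10.5]` and `ζ' ≠ 0` on `(0,½) × (0, 10]`; classically Gram 1903 and
Spira 1965). The literal `Literature.NumberTheory.LFunctions.ZetaLowHeightZeros.ZetaNum.certDZeta8to10h` lists, for the four edges of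
`[0, ½] × [8, 21/2]`, pieces with quadrant labels (scaled integers at `2^48`); it was produced by
an external planner that mirrors the checker bit for bit, but its validity rests only on the
kernel evaluation `Literature.RH.ZetaNum.certDZeta8to10h_ok : certCheck 1 certDZeta8to10h = true`
(`decide +kernel`, Euler–Maclaurin `N = 6` enclosures in fixed-point interval arithmetic and the
winding-number certificate theorem; see `ZetaLowHeightZeros.lean`). No axioms beyond
`propext`, `Classical.choice`, `Quot.sound`.

## Main results

* `Literature.NumberTheory.LFunctions.ZetaLowHeightZeros.ZetaNum.certDZeta8to10h_ok` — the kernel check.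
* `Literature.NumberTheory.LFunctions.ZetaLowHeightZeros.ZetaNum.deriv_riemannZeta_ne_zero_DZeta8to10h` — `ζ'(s) ≠ 0` for `0 < Re s < ½`, `8 < Im s ≤ 21/2`.
-/

namespace Literature.NumberTheory.LFunctions.ZetaLowHeightZeros.ZetaNum

/-- The certificate data for `ζ'` on `[0, ½] × [8, 21/2]` (bottom, right, top, left edges).
[folklore] -/
def certDZeta8to10h : ZetaNum.Cert :=
  ⟨2251799813685248, 2955487255461888, 76021994881024, 3, [(140737488355328, 3)],
  2300718417444864, 3, [(2348913319215104, 3), (2396049511546880, 3), (2441788765765632, 3), (2489058102083584, 2), (2539288818352128, 2), (2592419711287296, 2), (2648291867099136, 2), (2706702348582912, 2), (2766843701886976, 2), (2828113557848064, 2), (2889852638986240, 2), (2951293219897344, 2), (2955487255461888, 2)],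
  100354058354688, 2, [(140737488355328, 2)],
  2291606644326400, 3, [(2331366230327296, 3), (2370934690283520, 3), (2410165995307008, 3), (2448880830513152, 3), (2486731303550976, 3), (2524956512485376, 2), (2565361417322496, 2), (2607940649353216, 2), (2652702798512128, 2), (2699615652544512, 2), (2748300180586496, 2), (2798434260090880, 2), (2849748381859840, 2), (2901915054637056, 2), (2954543436398592, 2), (2955487255461888, 2)]⟩

/-- **The kernel check of the certificate.** [folklore] -/
theorem certDZeta8to10h_ok : ZetaNum.certCheck 1 certDZeta8to10h = true := by
  decide +kernel

/-- **`ζ'(s) ≠ 0` for `0 < Re s < ½`, `8 < Im s ≤ 21/2`** (certified computation).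
[folklore] -/
theorem deriv_riemannZeta_ne_zero_DZeta8to10h {s : ℂ} (h0 : 0 < s.re) (h1 : s.re < 1 / 2)
    (h2 : (8 : ℝ) < s.im) (h3 : s.im ≤ 21 / 2) : deriv riemannZeta s ≠ 0 :=
  ZetaNum.deriv_riemannZeta_ne_zero_of_certCheck certDZeta8to10h_ok h0 h1
    (by norm_num [certDZeta8to10h, Literature.Analysis.ValidatedNumerics.Numerics.SC]; exact h2)
    (by norm_num [certDZeta8to10h, Literature.Analysis.ValidatedNumerics.Numerics.SC]; exact h3)

end Literature.NumberTheory.LFunctions.ZetaLowHeightZeros.ZetaNum
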